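import Mathlib
import Summits.ValiantsHypothesis.ValiantsHypothesis.Theorems.BarrierLeverPartitionMinorsHitByVPHiddenStatesFullJoinLeaf
import Summits.ValiantsHypothesis.ValiantsHypothesis.Theorems.BarrierLeverPartitionMinorsHitByVPHiddenStatesFullJoinDoorPow

/-!
# Route BarrierLever — item `PartitionMinorsHitByVP` (stmt-ValiantsHypothesis-19717), line `hidden_states`:
# EVERY POLYNOMIALLY LARGE MINOR IS HIT — `r ≤ h^e + 1` rows, witness in `SmallCircuits ℂ (h+h) (e+5)`, all `h ≥ 3`

Helper file (`--supports stmt-ValiantsHypothesis-19717`; cell valiant-natproofs, rung V4, 𝒟-side door (c), line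
`Cruxes/PartitionMinorsHitByVP/Lines/hidden_states.lean` v8; prover seat val-np-p3 gen 16). Definition-free. Closes NO item.

THE POINT (memo val-np-p3 g16 «full join» §13(d), §16–§17). The item quantifies over ALL `r ≤ 2^h`; its whole difficulty is exponential
`r`. For polynomially many rows it is settled here, uniformly and unconditionally: for every exponent `e`, every `h ≥ 3` and EVERY pair of
injective families `u, w : Fin r → Finset (Fin h)` with `r ≤ h^e + 1`, some `f ∈ SmallCircuits ℂ (h + h) (e + 5)` has a nonsingular partition
matrix on `(u, w)` (`partitionMinor_hit_of_card_le_pow`). Proof: the star leaf p675793 (`fullJoinCube_of_le`: with `K = r − 1` states the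
flat design is `∅` + singletons = `r` generic points, unisolvent for any `r` monomials on each side) through the free-exponent door p680177.
This is the `d = 1` layer of conjecture UTD-flat (§16); the item is the statement that `K = poly(h)` states also serve exponential `r`.

WHAT THIS IS NOT: nothing for `r > h^e + 1`; item 19717 stays OPEN; nothing on crux 14610 or VP ≠ VNP.
-/

set_option linter.dupNamespace false

namespace Summit.ValiantsHypothesis.ValiantsHypothesis.Theorems.BarrierLever.HiddenStates

open Finset Matrix
open Literature.Barriers.ValiantsHypothesis

noncomputable section

namespace FullJoin

variable {h r : ℕ}

/-- **Every minor with at most `h^e + 1` rows is hit by `SmallCircuits ℂ (h+h) (e+5)`** (all `h ≥ 3`, all injective layouts, lower or not). -/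
theorem partitionMinor_hit_of_card_le_pow (e : ℕ) (hh : 3 ≤ h) (hr : r ≤ h ^ e + 1) (u w : Fin r → Finset (Fin h))
    (hu : Function.Injective u) (hw : Function.Injective w) :
    ∃ f ∈ SmallCircuits ℂ (h + h) (e + 5),
      (Matrix.of fun i j : Fin r => MvPolynomial.coeff
        (∑ a ∈ u i, Finsupp.single (Fin.castAdd h a) 1 +
          ∑ c ∈ w j, Finsupp.single (Fin.natAdd h c) 1) f).det ≠ 0 :=
  partitionMinor_hit_of_oneCube_pow (K := h ^ e) e hh le_rfl u w (fullJoinCube_of_le u w hu hw hr)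

/-- The same with the row count as the only parameter: minors with `r ≤ h + 1` rows are hit inside `SmallCircuits ℂ (h+h) 6`. -/
theorem partitionMinor_hit_of_card_le_succ (hh : 3 ≤ h) (hr : r ≤ h + 1) (u w : Fin r → Finset (Fin h))
    (hu : Function.Injective u) (hw : Function.Injective w) :
    ∃ f ∈ SmallCircuits ℂ (h + h) 6,
      (Matrix.of fun i j : Fin r => MvPolynomial.coeff
        (∑ a ∈ u i, Finsupp.single (Fin.castAdd h a) 1 +
          ∑ c ∈ w j, Finsupp.single (Fin.natAdd h c) 1) f).det ≠ 0 :=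
  partitionMinor_hit_of_card_le_pow 1 hh (by simpa using hr) u w hu hw

end FullJoin

end

end Summit.ValiantsHypothesis.ValiantsHypothesis.Theorems.BarrierLever.HiddenStates
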